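import Summits.ResolutionOfSingularities.ResolutionOfSingularities.Theorems.FrobeniusClosingPatchingRelPerfectCoreRungTowerHypersurface
import HarnessLib

/-!
# Crux `PatchingRelPerfect` (stmt-ResolutionOfSingularities-16161), chain w52 — CORE RUNG r1τ,
# part 5: hypersurface thickenings decided by the INITIAL FORM (Proj-free)

[OURS · L1 W5.2 · rung r1τ] The chart condition of part 4 (`…CoreRungTowerHypersurface.lean`:
a weak transform `Q_i ∉ x_i B_i` with `B_i/(x_i, Q_i)` regular on every Rees chart `B_i` of
`Bl_𝔪 Spec S`) is discharged from the INITIAL FORM of the equation: for `q = F(x) + r` with `F`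
a form of degree `d` in the regular system of parameters `x` and `r ∈ 𝔪ᵈ⁺¹`, the weak transform
on `B_i` is `F(e) + x_i·(r / x_iᵈ⁺¹)`, and modulo `x_i` it is the DEHOMOGENISED REDUCED FORM
`F̄(T)|_{T_i = 1} ∈ κ[T_j : j ≠ i]`, `κ = S/𝔪` (`chartQuotEquiv`, Stacks 0BIQ).  Hence
(PROVED, every regular local `S` of every dimension, every `e`):

* `CoreRungTower.exists_weakTransform_of_form` — the weak transform and its residue;
  `CoreRungTower.notMem_span_of_mk_eq`, `CoreRungTower.isRegularRing_quot_pair_of_mk_eq` — the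
  two chart conditions from `F̄_i ≠ 0` and `κ[T_j : j ≠ i]/(F̄_i)` regular;
* `coreRung_form_sup_pow`, `coreRung_form_frobeniusMember` (+ companions) — if for every `i` the
  dehomogenised reduced initial form `F̄_i` is non-zero with `κ[T_j : j ≠ i]/(F̄_i)` a regular
  ring (the projective tangent cone `V(F̄) ⊆ ℙ^{n-1}_κ` is a regular hypersurface), then
  `(q) + 𝔪^{d+e+1}` and `(q) + (x₁ᵃ, …, x_nᵃ)`, `a = d + e + 1`, are in the companion class and
  their blowing ups satisfy the conclusion of the blow-up-form open core `AtomDimFourBlowupAt`.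

This is the Proj-free "initial form regular ⇒ FOUND for every thickness" statement of
CORE-MECHANISM-NOTE §1 / stub-3 NOTE (2) (e = 0: stub-4's tangent-cone rung r1t); the located wild
kernel (SINGULAR `V(F̄)`, CHAIN v1.2 §4) is exactly the failure of the regularity input.  FORMAT
evidence for the core (CHAIN §1 (A)); nothing here is a statement of the manuscript under review.

## References

* The Stacks Project, Tags 0BIQ, 0804, 080A. [StacksProject]
* Q. Liu, *Algebraic Geometry and Arithmetic Curves*, OUP 2002, Thm. 8.1.19 (a). [Liu2002]
-/

-- `Summit.<Summit>.<Sub>.Theorems` with `Sub = Summit` (single-conjunct summit, D-0017)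
set_option linter.dupNamespace false

noncomputable section

open CategoryTheory CategoryTheory.Limits AlgebraicGeometry Literature.AlgebraicGeometry.Resolution

namespace Summit.ResolutionOfSingularities.ResolutionOfSingularities.Theorems

universe u

/-! ## The weak transform of a form on a Rees chart (any ring) -/

section InitialForm

variable {S : Type u} [CommRing S] {n : ℕ} (x : Fin n → S) (i : Fin n)

local notation3 "Pκ" => MvPolynomial {j : Fin n // j ≠ i} (S ⧸ Ideal.span (Set.range x))

/-- Reducing coefficients commutes with killing the variable `T_i` (`T_i ↦ 1`, `T_j ↦ T_j`).
[folklore] -/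
theorem CoreRungTower.map_aeval_kill (F : MvPolynomial (Fin n) S) :
    MvPolynomial.map (Ideal.Quotient.mk (Ideal.span (Set.range x)))
      (MvPolynomial.aeval (fun j : Fin n => if h : j = i then
        (1 : MvPolynomial {j : Fin n // j ≠ i} S) else MvPolynomial.X ⟨j, h⟩) F) =
      MvPolynomial.aeval (fun j : Fin n => if h : j = i then (1 : Pκ) else MvPolynomial.X ⟨j, h⟩)
        (MvPolynomial.map (Ideal.Quotient.mk (Ideal.span (Set.range x))) F) := by
  rw [MvPolynomial.aeval_eq_bind₁, MvPolynomial.aeval_eq_bind₁, MvPolynomial.map_bind₁]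
  have hfun : (fun j : Fin n => MvPolynomial.map (Ideal.Quotient.mk (Ideal.span (Set.range x)))
      (if h : j = i then (1 : MvPolynomial {j : Fin n // j ≠ i} S) else MvPolynomial.X ⟨j, h⟩)) =
      (fun j : Fin n => if h : j = i then (1 : Pκ) else MvPolynomial.X ⟨j, h⟩) := by
    funext j
    by_cases h : j = i
    · rw [dif_pos h, dif_pos h, map_one]
    · rw [dif_neg h, dif_neg h, MvPolynomial.map_X]
  rw [hfun]

/-- **The weak transform of `q = F(x) + r` on the chart `D₊(x_i t)`** (`F` a form of degree `d`,
`r ∈ (x)ᵈ⁺¹`): `q = x_iᵈ · Q` with `Q = F(e) + x_i · (r/x_iᵈ⁺¹)`, and modulo `x_i` the weak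
transform is the dehomogenised reduced form `F̄(T)|_{T_i = 1}` under
`(S/(x))[T_j : j ≠ i] → B_i/(x_i)` (`chartQuotMap`). [cite: StacksProject, Tag 0BIQ] -/
theorem CoreRungTower.exists_weakTransform_of_form {d : ℕ} {F : MvPolynomial (Fin n) S}
    (hF : F.IsHomogeneous d) {r : S} (hr : r ∈ Ideal.span (Set.range x) ^ (d + 1)) :
    ∃ Q : chartRing x i,
      chartBase x i (MvPolynomial.eval x F + r) = chartBase x i (x i) ^ d * Q ∧
      Ideal.Quotient.mk (Ideal.span {chartBase x i (x i)}) Q = chartQuotMap x i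
        (MvPolynomial.aeval (fun j : Fin n => if h : j = i then (1 : Pκ) else MvPolynomial.X ⟨j, h⟩)
          (MvPolynomial.map (Ideal.Quotient.mk (Ideal.span (Set.range x))) F)) := by
  have hr' : chartBase x i r ∈ Ideal.span {chartBase x i (x i) ^ (d + 1)} := by
    have h := Ideal.mem_map_of_mem (chartBase x i) hr
    rwa [Ideal.map_pow, map_reesChartBase_eq (x i) (Ideal.mem_span_range_self (f := x) (x := i)),
      Ideal.span_singleton_pow] at h
  obtain ⟨c, hc⟩ := Ideal.mem_span_singleton'.mp hr'
  refine ⟨MvPolynomial.eval₂Hom (chartBase x i) (fun j => chartGen x i j) F +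
    chartBase x i (x i) * c, ?_, ?_⟩
  · rw [map_add, reesChartBase_eval_eq_pow_mul_eval₂ x i hF, ← hc]
    ring
  · have h1 : Ideal.Quotient.mk (Ideal.span {chartBase x i (x i)}) (chartBase x i (x i) * c) = 0 :=
      Ideal.Quotient.eq_zero_iff_mem.mpr (Ideal.mul_mem_right _ _ (Ideal.mem_span_singleton_self _))
    rw [map_add, h1, add_zero]
    have h2 : MvPolynomial.eval₂Hom (chartBase x i) (fun j => chartGen x i j) F =
        MvPolynomial.eval₂Hom (chartBase x i) (fun j : {j : Fin n // j ≠ i} => chartGen x i j.1)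
          (MvPolynomial.aeval (fun j : Fin n => if h : j = i then
            (1 : MvPolynomial {j : Fin n // j ≠ i} S) else MvPolynomial.X ⟨j, h⟩) F) :=
      (DFunLike.congr_fun (eval₂Hom_comp_aeval_kill x i) F).symm
    have h3 := DFunLike.congr_fun (chartQuotMap_comp_map x i)
      (MvPolynomial.aeval (fun j : Fin n => if h : j = i then
        (1 : MvPolynomial {j : Fin n // j ≠ i} S) else MvPolynomial.X ⟨j, h⟩) F)
    rw [RingHom.comp_apply, RingHom.comp_apply, CoreRungTower.map_aeval_kill] at h3
    rw [h2, ← h3]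

/-- **Non-divisibility of the weak transform by `x_i`** from the non-vanishing of its residue
polynomial (`x` quasi-regular, so `(S/(x))[T] → B_i/(x_i)` is injective).
[cite: StacksProject, Tag 0BIQ] -/
theorem CoreRungTower.notMem_span_of_mk_eq (hq : IsQuasiRegular x) {Q : chartRing x i} {G : Pκ}
    (hQG : Ideal.Quotient.mk (Ideal.span {chartBase x i (x i)}) Q = chartQuotMap x i G)
    (hG : G ≠ 0) : Q ∉ Ideal.span {chartBase x i (x i)} := fun hmem =>
  hG ((chartQuotMap_bijective x i hq).1
    (by rw [← hQG, map_zero]; exact Ideal.Quotient.eq_zero_iff_mem.mpr hmem))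

/-- **Regularity of `B_i/(x_i, Q)`** from the regularity of `(S/(x))[T_j : j ≠ i]/(G)`, `G` the
residue polynomial of `Q` (`B_i/(x_i) ≅ (S/(x))[T_j : j ≠ i]`, `chartQuotEquiv`).
[cite: StacksProject, Tag 0BIQ] -/
theorem CoreRungTower.isRegularRing_quot_pair_of_mk_eq (hq : IsQuasiRegular x) {Q : chartRing x i}
    {G : Pκ} (hQG : Ideal.Quotient.mk (Ideal.span {chartBase x i (x i)}) Q = chartQuotMap x i G)
    [IsRegularRing (Pκ ⧸ Ideal.span {G})] :
    IsRegularRing (chartRing x i ⧸ Ideal.span {chartBase x i (x i), Q}) := by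
  classical
  have hK₀map : (Ideal.span {chartBase x i (x i), Q}).map
      (Ideal.Quotient.mk (Ideal.span {chartBase x i (x i)})) =
      (Ideal.span {G}).map (chartQuotEquiv x i hq : Pκ →+* chartRing x i ⧸
        Ideal.span {chartBase x i (x i)}) := by
    have h0 : Ideal.Quotient.mk (Ideal.span {chartBase x i (x i)}) (chartBase x i (x i)) = 0 :=
      Ideal.Quotient.eq_zero_iff_mem.mpr (Ideal.subset_span rfl)
    rw [Ideal.map_span, Set.image_insert_eq, Set.image_singleton, Ideal.map_span,
      Set.image_singleton, RingHom.coe_coe, chartQuotEquiv_apply, ← hQG, h0, Ideal.span_insert,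
      Ideal.span_singleton_eq_bot.mpr rfl, bot_sup_eq]
  have e2 : (chartRing x i ⧸ Ideal.span {chartBase x i (x i)}) ⧸
      (Ideal.span {chartBase x i (x i), Q}).map
        (Ideal.Quotient.mk (Ideal.span {chartBase x i (x i)})) ≃+* Pκ ⧸ Ideal.span {G} :=
    (Ideal.quotientEquiv (Ideal.span {G}) _ (chartQuotEquiv x i hq) hK₀map).symm
  have hle : Ideal.span {chartBase x i (x i)} ≤ Ideal.span {chartBase x i (x i), Q} := by
    rw [Ideal.span_singleton_le_iff_mem]
    exact Ideal.subset_span (Set.mem_insert _ _)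
  have e1 := (DoubleQuot.quotQuotEquivQuotOfLE hle).symm
  exact IsRegularRing.of_ringEquiv (R := Pκ ⧸ Ideal.span {G}) (e2.symm.trans e1.symm)

end InitialForm

/-! ## The rung: hypersurface thickenings with regular projective tangent cone -/

section FormRung

variable {S : Type u} [CommRing S] [IsRegularLocalRing S] {n : ℕ} (x : Fin n → S)
  (hx : Ideal.span (Set.range x) = IsLocalRing.maximalIdeal S)
  (hd : (IsLocalRing.maximalIdeal S).spanFinrank = n)
  {d : ℕ} (F : MvPolynomial (Fin n) S) (hF : F.IsHomogeneous d) (r : S)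
  (hr : r ∈ IsLocalRing.maximalIdeal S ^ (d + 1))
  (hform : ∀ i : Fin n,
    MvPolynomial.aeval (fun j : Fin n => if h : j = i then
        (1 : MvPolynomial {j : Fin n // j ≠ i} (S ⧸ Ideal.span (Set.range x)))
      else MvPolynomial.X ⟨j, h⟩)
      (MvPolynomial.map (Ideal.Quotient.mk (Ideal.span (Set.range x))) F) ≠ 0 ∧
    IsRegularRing (MvPolynomial {j : Fin n // j ≠ i} (S ⧸ Ideal.span (Set.range x)) ⧸
      Ideal.span {MvPolynomial.aeval (fun j : Fin n => if h : j = i then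
          (1 : MvPolynomial {j : Fin n // j ≠ i} (S ⧸ Ideal.span (Set.range x)))
        else MvPolynomial.X ⟨j, h⟩)
        (MvPolynomial.map (Ideal.Quotient.mk (Ideal.span (Set.range x))) F)}))

include hx hd hF hr hform in
/-- **Chart data from the initial form**: weak transforms `Q_i` of `q = F(x) + r` on all charts,
with `Q_i ∉ x_i B_i` and `B_i/(x_i, Q_i)` regular. [cite: StacksProject, Tag 0BIQ] -/
theorem CoreRungTower.exists_chartData_of_form :
    ∃ Q : ∀ i : Fin n, chartRing x i,
      (∀ i, chartBase x i (MvPolynomial.eval x F + r) = chartBase x i (x i) ^ d * Q i) ∧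
      (∀ i, Q i ∉ Ideal.span {chartBase x i (x i)}) ∧
      (∀ i, IsRegularRing (chartRing x i ⧸ Ideal.span {chartBase x i (x i), Q i})) := by
  have hq : IsQuasiRegular x := isQuasiRegular_regularSystemOfParameters hd x hx
  have hr' : r ∈ Ideal.span (Set.range x) ^ (d + 1) := by rwa [hx]
  choose Q hQ hQG using fun i => CoreRungTower.exists_weakTransform_of_form x i hF hr'
  refine ⟨Q, hQ, fun i => CoreRungTower.notMem_span_of_mk_eq x i hq (hQG i) (hform i).1,
    fun i => ?_⟩
  haveI := (hform i).2
  exact CoreRungTower.isRegularRing_quot_pair_of_mk_eq x i hq (hQG i)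

include hx hd hF hr hform in
/-- **`(q) + 𝔪^{d+e+1} ∈ 𝒞 for `q = F(x) + r` with regular projective tangent cone** (`F̄_i ≠ 0`
and `κ[T_j : j ≠ i]/(F̄_i)` regular for every `i`), every `e`. [cite: StacksProject, Tag 080A]
[cite: Liu2002, Thm. 8.1.19 (a)] -/
theorem companion_form_sup_pow (e : ℕ) :
    ∃ (P : Ideal S) (m' : ℕ), IsLocalRing.maximalIdeal S ^ m' ≤ P ∧
      ∃ (B : Scheme.{u}) (b : B ⟶ Spec (.of S)),
        IsBlowup b (affineBlowup.idealSheaf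
          ((Ideal.span {MvPolynomial.eval x F + r} ⊔ IsLocalRing.maximalIdeal S ^ (d + e + 1)) *
            P)) ∧ Scheme.IsRegular B := by
  obtain ⟨Q, hQ, hnot, hreg⟩ := CoreRungTower.exists_chartData_of_form x hx hd F hF r hr hform
  exact companion_hypersurface_sup_pow x hx hd _ d Q hQ hnot hreg e

include hx hd hF hr hform in
/-- **CORE RUNG r1τ — hypersurface thickenings by the initial form.** `S` regular local with
minimal basis `x` of `𝔪`, `q = F(x) + r` with `F` a form of degree `d`, `r ∈ 𝔪ᵈ⁺¹`, and regular
projective tangent cone chart by chart (`F̄_i ≠ 0`, `κ[T_j : j ≠ i]/(F̄_i)` regular): every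
blowing up of `Spec S` along `(q) + 𝔪^{d+e+1} ≠ 0` satisfies the conclusion of the blow-up-form
open core `AtomDimFourBlowupAt`, for every `e`.  Every dimension, every regular local base.
[cite: StacksProject, Tag 080A] [cite: Liu2002, Thm. 8.1.19 (a)] -/
theorem coreRung_form_sup_pow (e : ℕ)
    (hI : Ideal.span {MvPolynomial.eval x F + r} ⊔ IsLocalRing.maximalIdeal S ^ (d + e + 1) ≠ ⊥)
    (T : Scheme.{u}) (f : T ⟶ Spec (.of S))
    (hf : IsBlowup f (affineBlowup.idealSheaf
      (Ideal.span {MvPolynomial.eval x F + r} ⊔ IsLocalRing.maximalIdeal S ^ (d + e + 1)))) :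
    ∃ (J : T.IdealSheafData) (T' : Scheme.{u}) (π : T' ⟶ T), J ≠ ⊥ ∧
      (∀ t : T, t ∈ J.support → f.base t = IsLocalRing.closedPoint S) ∧
      IsBlowup π J ∧ Scheme.IsRegular T' :=
  atomConclusion_of_companion' hI (companion_form_sup_pow x hx hd F hF r hr hform e) T f hf

include hx hd hF hr hform in
/-- **`(q) + (x₁ᵃ, …, x_nᵃ) ∈ 𝒞`, `a = d + e + 1`, for `q = F(x) + r` with regular projective
tangent cone**, every `e`. [cite: StacksProject, Tag 080A] -/
theorem companion_form_frobeniusMember (e : ℕ) :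
    ∃ (P : Ideal S) (m' : ℕ), IsLocalRing.maximalIdeal S ^ m' ≤ P ∧
      ∃ (B : Scheme.{u}) (b : B ⟶ Spec (.of S)),
        IsBlowup b (affineBlowup.idealSheaf
          ((Ideal.span {MvPolynomial.eval x F + r} ⊔
            Ideal.span (Set.range fun j => x j ^ (d + e + 1))) * P)) ∧ Scheme.IsRegular B := by
  obtain ⟨Q, hQ, hnot, hreg⟩ := CoreRungTower.exists_chartData_of_form x hx hd F hF r hr hform
  exact companion_hypersurface_frobeniusMember x hx hd _ d Q hQ hnot hreg e

include hx hd hF hr hform in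
/-- **CORE RUNG r1τ — Frobenius members by the initial form.** With `q = F(x) + r` as above
(regular projective tangent cone), every blowing up of `Spec S` along
`I = (q) + (x₁ᵃ, …, x_nᵃ) ≠ 0`, `a = d + e + 1`, satisfies the conclusion of the blow-up-form open
core — the hunt shape `(x_iᵖ) + (q)`, `ord q = d < p`, FOUND for every `p` as soon as the
tangent cone of `q` is a regular projective hypersurface. [cite: StacksProject, Tag 080A]
[cite: Liu2002, Thm. 8.1.19 (a)] -/
theorem coreRung_form_frobeniusMember (e : ℕ)
    (hI : Ideal.span {MvPolynomial.eval x F + r} ⊔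
      Ideal.span (Set.range fun j => x j ^ (d + e + 1)) ≠ ⊥)
    (T : Scheme.{u}) (f : T ⟶ Spec (.of S))
    (hf : IsBlowup f (affineBlowup.idealSheaf
      (Ideal.span {MvPolynomial.eval x F + r} ⊔
        Ideal.span (Set.range fun j => x j ^ (d + e + 1))))) :
    ∃ (J : T.IdealSheafData) (T' : Scheme.{u}) (π : T' ⟶ T), J ≠ ⊥ ∧
      (∀ t : T, t ∈ J.support → f.base t = IsLocalRing.closedPoint S) ∧
      IsBlowup π J ∧ Scheme.IsRegular T' :=
  atomConclusion_of_companion' hI (companion_form_frobeniusMember x hx hd F hF r hr hform e) T f hf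

end FormRung

end Summit.ResolutionOfSingularities.ResolutionOfSingularities.Theorems

end
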